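import Literature.IUT.HodgeArakelov.ThetaSettingCompletionPackageGeomIdent
import Literature.IUT.HodgeArakelov.AbsTopMonoidsGenuineRmk181OfSetting
import Literature.IUT.HodgeArakelov.GaloisPairRigidityGenuine
import Literature.AnabelianGeometry.EtaleTheta.SettingModelTateGroupLevel
import Literature.AnabelianGeometry.EtaleTheta.SettingModelTatePairKernelNontrivial
import HarnessLib

/-!
# The ALL-FIELDS-GENUINE `AbsTopMonoids` producer of [IUTchII] Ex. 1.8 AT THE STAGE-2 TATE MODEL — UNCONDITIONAL:
# (H1) and (H2) are tree theorems there

S. Mochizuki, *Inter-universal Teichmüller theory II*, §1, Example 1.8 (ii)–(iv) (kurims pp. 35–39), Remark 1.8.1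
(pp. 41–42), Remark 1.11.1 (i) (pp. 49–50) [claim: Mochizuki2012, status: disputed].

Cell `abc-iut`, seat abc-iut-L6-d2 (gen 9), K-L6 row «EX18-ALLGENUINE@modelTate» (abc-iut-L6-lead §F v1.19dh GO).
PROOF-ONLY (no definitions, no instances, no named facts).  The closers of record of the nodes
IUTchII:Ex1.8(ii)(iii)(iv) / Rmk1.8.1 / Rmk1.11.1(i) / Rmk1.11.3(ii) are this lineage's ALL-FIELDS-GENUINE producers
`AbsTopMonoids.exists_allGenuine_ofDoubleUnderlinePadic(_of_isOpenMap)` (p431329) and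
`AbsTopMonoids.exists_allGenuine_rmk181_ofDoubleUnderlinePadic(_of_isOpenMap)` (built on `genuineOfModelIsm`, p427597) at
the GENUINE [IUTchII] §1 setting `S := ThetaSetting.ofDoubleUnderline C μ …` of an [EtTh] §1 theta setting `D`, whose ONLY
residual binders are
* (H1) `hΔ` — «every automorphism of topological groups of `Π^tp_{X̲̲}` carries `Δ` onto itself» ([AbsTopI] Thm 2.6 (v));
* (H2) — «`Π^tp_X → G_K` is an open map» (tempered + Galois-countable `Π^tp_X`, [SemiAnbd] Ex. 3.10).

At the stage-2 Tate model `D := ThetaSetting.modelχq p i j` (`Π^tp_X = (F̂₂ ×_Ẑ ℤ) ⋊_{(κ_p^i, κ_p^j, χ)} G_{ℚ_p}`;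
abc-iut-L2 / abc-iut-L6-d6) BOTH are tree theorems, consumed here BY NAME:
* (H1) ⟸ `hI0 : Ker (tatePairHom p i j) ≠ ⊥` — abc-iut-w4-d044's
  `SettingModel.deltaX_characteristic_ofDoubleUnderline_modelχq_of_ker_ne_bot'` (p486362, the (ii-b)-IDENT file; character for
  character the `hΔ` binder type) — and `hI0` ITSELF is abc-iut-w4-d044's theorem `SettingModel.ker_tatePairHom_ne_bot`
  (p488367: Lemma Z + `κ`-injectivity + elasticity of `G_{ℚ_p}` [AbsTopI] Thm 1.7 (ii)), for every `i j`;
* (H2) ⟸ the [SemiAnbd] §6 parameter bundle `TemperedCurve.GroupLevelData (curveχq p i j)`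
  (`SettingModel.nonempty_groupLevelData_curveχq_holds`, abc-iut-L6-d6) through `ThetaSetting.isOpenMap_augGK_mk_of_groupLevelData`.

RESULTS (for EVERY `X̲̲`-choice `C` over `modelχq p i j`, every level datum `μ`, every theta cocycle `η`):
* `isOpenMap_augGK_mk_modelχq`, `nonempty_quotDeltaX_iso_ofDoubleUnderline_modelχq` — (H2) at the model, hypothesis-free;
* `exists_allGenuine_ofDoubleUnderlinePadic_modelχq_of_ker_ne_bot` / **`…_modelχq`** — Ex. 1.8 (ii)–(iv): an
  `AbsTopMonoids S` with `O^⊳(G) = 𝒪^⊳_{ℚ̄_p}` (genuine), `Ism(G) =` print's isometry group, `−1 ∈ Ẑ^×` acting on `O^{×μ}(G)`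
  by inversion, and `Rmk1111_d` — display form modulo `hI0`, then UNCONDITIONAL;
* `exists_allGenuine_rmk181_ofDoubleUnderlinePadic_modelχq_of_ker_ne_bot` / **`…_modelχq`** — Rmk. 1.8.1 (`Rmk181_statement`)
  at such a producer — display form, then UNCONDITIONAL;
* `exists_allGenuine_laws_ofDoubleUnderlinePadic_modelχq_of_ker_ne_bot` / **`…_modelχq`** — ONE producer carrying all of the
  above together with the continuity laws of Ex. 1.8 (ii) and `Rmk1111_a` (Rmk. 1.11.1 (i) (a): `Aut(G ↷ O^⊳(G)) → Aut(G)`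
  bijective) — display form, then UNCONDITIONAL.
K-L6 reading: the display of these custody cells at the Tate model moves from {(H1), (H2)} to ∅ — no model-side binder left.

HONEST FRAMING: `modelχq` is a SEMI-SYNTHETIC model (binder-discharge / joint-satisfiability evidence for OUR typed interface,
not the tempered `π₁` of a curve); classical group theory + tree theorems only; nothing here bears on [IUTchIII] Cor. 3.12
or takes a side; typed ≠ proved elsewhere; instantiated ≠ endorsed; nothing asserts abc proved or refuted.
-/

set_option autoImplicit false

noncomputable section

namespace Literature.IUT.HodgeArakelov

open Literature.AnabelianGeometry.AbsoluteAnabelian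
open Literature.AnabelianGeometry.EtaleTheta Literature.AnabelianGeometry.SemiGraphs
open Literature.AnabelianGeometry.EtaleTheta.SettingModel
open scoped Literature.AnabelianGeometry.EtaleTheta

namespace AbsTopMonoids

variable (p : ℕ) [Fact p.Prime] (i j : ℤ) (hj : Even j)

/-- **(H2) at the stage-2 Tate model, hypothesis-free**: `Π^tp_X → G_K` (co-restricted augmentation of
`modelχq p i j`) is an open map — from the [SemiAnbd] §6 bundle `GroupLevelData (curveχq p i j)` (tempered,
Galois-countable). [cite: MochizukiSemiAnbd2006, Ex 3.10 p.45] -/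
theorem isOpenMap_augGK_mk_modelχq :
    IsOpenMap fun x : (Literature.AnabelianGeometry.EtaleTheta.ThetaSetting.modelχq p i j hj).PiTemp =>
      (⟨(Literature.AnabelianGeometry.EtaleTheta.ThetaSetting.modelχq p i j hj).aug x,
        (Literature.AnabelianGeometry.EtaleTheta.ThetaSetting.modelχq p i j hj).aug_mem_GK x⟩ :
        (Literature.AnabelianGeometry.EtaleTheta.ThetaSetting.modelχq p i j hj).GK) := by
  obtain ⟨d⟩ := nonempty_groupLevelData_curveχq_holds p i j
  exact (Literature.AnabelianGeometry.EtaleTheta.ThetaSetting.modelχq p i j hj).isOpenMap_augGK_mk_of_groupLevelData d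

variable {ED : (Literature.AnabelianGeometry.EtaleTheta.ThetaSetting.modelχq p i j hj).EtaleThetaData} {l : ℕ}
  (C : ED.DoubleUnderline l) {N : ℕ+}
  (μ : (Literature.AnabelianGeometry.EtaleTheta.ThetaSetting.modelχq p i j hj).CyclotomeMod l N)
  (hC : (Literature.AnabelianGeometry.EtaleTheta.ThetaSetting.modelχq p i j hj).Compat)
  (hS : (Literature.AnabelianGeometry.EtaleTheta.ThetaSetting.modelχq p i j hj).Sec2Hyps)
  (hl : l.Prime) (hp2 : p ≠ 2) (hpl : p ≠ l)
  (hζ : ∃ ζ : (Literature.AnabelianGeometry.EtaleTheta.ThetaSetting.modelχq p i j hj).K, IsPrimitiveRoot ζ (4 * l))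
  {η : (C.thetaEnvData μ hC hS).PiYdd → MuN p N} (hη : η ∈ (C.thetaEnvData μ hC hS).thetaCocycles)

/-- **(H2) in the `hq` form at the [IUTchII] §1 setting of the Tate model**: `Π^tp_{X̲̲}/Δ ≅ G_K` topologically, for every
`X̲̲`-choice `C` over `modelχq p i j` (open augmentation through the open `Π^tp_{X̲̲} ≤ Π^tp_X`).
[claim: Mochizuki2012, status: disputed] (IUTchII §1 Ex 1.8 (i), kurims p.35) -/
theorem nonempty_quotDeltaX_iso_ofDoubleUnderline_modelχq :
    Nonempty (TopGroup.quot (ThetaSetting.ofDoubleUnderline C μ hC hS hl hp2 hpl hζ hη).PiX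
        (ThetaSetting.ofDoubleUnderline C μ hC hS hl hp2 hpl hζ hη).DeltaX ≃ₜ*
        (ThetaSetting.ofDoubleUnderline C μ hC hS hl hp2 hpl hζ hη).Gk) :=
  quotDeltaX_iso_of_isOpenMap _ ((isOpenMap_augGK_mk_modelχq p i j hj).comp C.isOpen_Huu.isOpenMap_subtype_val)

/-- **[IUTchII] Ex. 1.8 (ii)–(iv) — the ALL-FIELDS-GENUINE `AbsTopMonoids` at the Tate model, modulo `hI0` ALONE**: for every
`X̲̲`-choice `C` over `modelχq p i j` there is an `AbsTopMonoids` at `S = ofDoubleUnderline C μ …` over `(K, ℚ̄_p, ε = id)` with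
`O^⊳(G) = 𝒪^⊳_{ℚ̄_p}`, `Ism(G)` = print's isometry group of `G ↷ O^×(G)`, `−1 ∈ Ẑ^×` acting on `O^{×μ}(G)` by inversion, and
`Rmk1111_d`; (H1) from `hI0` (p486362), (H2) from the §6 bundle.
[claim: Mochizuki2012, status: disputed] (IUTchII §1 Ex 1.8 (iv), kurims p.39) -/
theorem exists_allGenuine_ofDoubleUnderlinePadic_modelχq_of_ker_ne_bot (hI0 : (tatePairHom p i j).ker ≠ ⊥) :
    ∃ A : AbsTopMonoids (ThetaSetting.ofDoubleUnderline C μ hC hS hl hp2 hpl hζ hη),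
      (∀ G, A.Otri G =
        (ModelMLFGaloisData.galois
          (Literature.AnabelianGeometry.EtaleTheta.ThetaSetting.modelχq p i j hj).toTemperedCurve.mlfClosurePadic.k
          (Literature.AnabelianGeometry.EtaleTheta.ThetaSetting.modelχq p i j hj).toTemperedCurve.mlfClosurePadic.K).tmPair.M) ∧
      (∀ G, A.Ism G = ↥(A.ism G)) ∧
      (∀ (G : IsoClass (ThetaSetting.ofDoubleUnderline C μ hC hS hl hp2 hpl hζ hη).Gk) (x : A.Oxmu G),
        A.actIsm G (A.toIsm G ZHatLevel.negOneAut) x = x⁻¹) ∧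
      Rmk1111_d A :=
  exists_allGenuine_ofDoubleUnderlinePadic_of_isOpenMap C μ hC hS hl hp2 hpl hζ hη (isOpenMap_augGK_mk_modelχq p i j hj)
    (deltaX_characteristic_ofDoubleUnderline_modelχq_of_ker_ne_bot' p i j hj C μ hC hS hl hp2 hpl hζ hη hI0)

/-- **[IUTchII] Rmk. 1.8.1 at the Tate model, modulo `hI0` ALONE**: for every `X̲̲`-choice `C` over `modelχq p i j` there is an
ALL-FIELDS-GENUINE `AbsTopMonoids` at `S = ofDoubleUnderline C μ …` (`O^⊳(G) = 𝒪^⊳_{ℚ̄_p}`, `Ism(G)` = print's isometry group)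
for which `Rmk181_statement` HOLDS. [claim: Mochizuki2012, status: disputed] (IUTchII §1 Rmk 1.8.1, kurims pp.41-42) -/
theorem exists_allGenuine_rmk181_ofDoubleUnderlinePadic_modelχq_of_ker_ne_bot (hI0 : (tatePairHom p i j).ker ≠ ⊥) :
    ∃ A : AbsTopMonoids (ThetaSetting.ofDoubleUnderline C μ hC hS hl hp2 hpl hζ hη),
      (∀ G, A.Otri G =
        (ModelMLFGaloisData.galois
          (Literature.AnabelianGeometry.EtaleTheta.ThetaSetting.modelχq p i j hj).toTemperedCurve.mlfClosurePadic.k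
          (Literature.AnabelianGeometry.EtaleTheta.ThetaSetting.modelχq p i j hj).toTemperedCurve.mlfClosurePadic.K).tmPair.M) ∧
      (∀ G, A.Ism G = ↥(A.ism G)) ∧ Rmk181_statement A :=
  exists_allGenuine_rmk181_ofDoubleUnderlinePadic_of_isOpenMap C μ hC hS hl hp2 hpl hζ hη
    (isOpenMap_augGK_mk_modelχq p i j hj)
    (deltaX_characteristic_ofDoubleUnderline_modelχq_of_ker_ne_bot' p i j hj C μ hC hS hl hp2 hpl hζ hη hI0)

/-- **ONE producer with all the laws, modulo `hI0` ALONE** — `genuineOfModelIsm` at `S = ofDoubleUnderline C μ …` over the Tate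
model, closure `(K, ℚ̄_p)`, `ε = galoisEpsilonPadic`, (H1) := p486362 at `hI0`, (H2) := the §6 bundle: `O^⊳(G) = 𝒪^⊳_{ℚ̄_p}`,
`Ism(G)` = print's isometry group, `−1` acts on `O^{×μ}(G)` by inversion, the continuity laws of Ex. 1.8 (ii) hold, and
Rmk. 1.11.1 (i) (a) (`Rmk1111_a`: `Aut(G ↷ O^⊳(G)) → Aut(G)` bijective), Rmk. 1.11.1 (i) (d) (`Rmk1111_d`) and Rmk. 1.8.1
(`Rmk181_statement`) HOLD for it. [claim: Mochizuki2012, status: disputed] (IUTchII §1 Rmk 1.11.1 (i), kurims pp.49-50) -/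
theorem exists_allGenuine_laws_ofDoubleUnderlinePadic_modelχq_of_ker_ne_bot (hI0 : (tatePairHom p i j).ker ≠ ⊥) :
    ∃ A : AbsTopMonoids (ThetaSetting.ofDoubleUnderline C μ hC hS hl hp2 hpl hζ hη),
      (∀ G, A.Otri G =
        (ModelMLFGaloisData.galois
          (Literature.AnabelianGeometry.EtaleTheta.ThetaSetting.modelχq p i j hj).toTemperedCurve.mlfClosurePadic.k
          (Literature.AnabelianGeometry.EtaleTheta.ThetaSetting.modelχq p i j hj).toTemperedCurve.mlfClosurePadic.K).tmPair.M) ∧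
      (∀ G, A.Ism G = ↥(A.ism G)) ∧
      (∀ (G : IsoClass (ThetaSetting.ofDoubleUnderline C μ hC hS hl hp2 hpl hζ hη).Gk) (x : A.Oxmu G),
        A.actIsm G (A.toIsm G ZHatLevel.negOneAut) x = x⁻¹) ∧
      A.ContinuityLaws ∧ Rmk1111_a A ∧ Rmk1111_d A ∧ Rmk181_statement A := by
  obtain ⟨hq⟩ := nonempty_quotDeltaX_iso_ofDoubleUnderline_modelχq p i j hj C μ hC hS hl hp2 hpl hζ hη
  have hΔ := deltaX_characteristic_ofDoubleUnderline_modelχq_of_ker_ne_bot' p i j hj C μ hC hS hl hp2 hpl hζ hη hI0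
  exact ⟨genuineOfModelIsm (ThetaSetting.ofDoubleUnderline C μ hC hS hl hp2 hpl hζ hη)
      (Literature.AnabelianGeometry.EtaleTheta.ThetaSetting.modelχq p i j hj).toTemperedCurve.mlfClosurePadic
      (Literature.AnabelianGeometry.EtaleTheta.ThetaSetting.modelχq p i j hj).toTemperedCurve.galoisEpsilonPadic hΔ ⟨hq⟩,
    fun _ => rfl, fun _ => rfl, fun G x => actIsm_toIsm_negOneAut _ _ _ hΔ ⟨hq⟩ G x,
    genuineOfModelIsm_continuityLaws _ _ _ hΔ ⟨hq⟩, rmk1111_a_genuineOfModelIsm _ _ _ hΔ ⟨hq⟩,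
    rmk1111_d_genuineOfModelIsm _ _ _ hΔ ⟨hq⟩, rmk181_genuineOfModelIsm _ _ _ hΔ ⟨hq⟩⟩

/-! ### UNCONDITIONAL forms: `hI0` is abc-iut-w4-d044's theorem `SettingModel.ker_tatePairHom_ne_bot` (p488367) -/

/-- **[IUTchII] Ex. 1.8 (ii)–(iv) — the ALL-FIELDS-GENUINE `AbsTopMonoids` at the Tate model, UNCONDITIONALLY**: for every
`X̲̲`-choice `C` over `modelχq p i j` there is an `AbsTopMonoids` at `S = ofDoubleUnderline C μ …` over `(K, ℚ̄_p, ε = id)` with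
`O^⊳(G) = 𝒪^⊳_{ℚ̄_p}`, `Ism(G)` = print's isometry group, `−1 ∈ Ẑ^×` acting on `O^{×μ}(G)` by inversion, and `Rmk1111_d`
((H1) := p486362 ∘ p488367, (H2) := the §6 bundle). [claim: Mochizuki2012, status: disputed] (IUTchII §1 Ex 1.8 (iv), kurims p.39) -/
theorem exists_allGenuine_ofDoubleUnderlinePadic_modelχq :
    ∃ A : AbsTopMonoids (ThetaSetting.ofDoubleUnderline C μ hC hS hl hp2 hpl hζ hη),
      (∀ G, A.Otri G =
        (ModelMLFGaloisData.galois
          (Literature.AnabelianGeometry.EtaleTheta.ThetaSetting.modelχq p i j hj).toTemperedCurve.mlfClosurePadic.k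
          (Literature.AnabelianGeometry.EtaleTheta.ThetaSetting.modelχq p i j hj).toTemperedCurve.mlfClosurePadic.K).tmPair.M) ∧
      (∀ G, A.Ism G = ↥(A.ism G)) ∧
      (∀ (G : IsoClass (ThetaSetting.ofDoubleUnderline C μ hC hS hl hp2 hpl hζ hη).Gk) (x : A.Oxmu G),
        A.actIsm G (A.toIsm G ZHatLevel.negOneAut) x = x⁻¹) ∧
      Rmk1111_d A :=
  exists_allGenuine_ofDoubleUnderlinePadic_modelχq_of_ker_ne_bot p i j hj C μ hC hS hl hp2 hpl hζ hη
    (ker_tatePairHom_ne_bot p i j)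

/-- **[IUTchII] Rmk. 1.8.1 at the Tate model, UNCONDITIONALLY**: for every `X̲̲`-choice `C` over `modelχq p i j` there is an
ALL-FIELDS-GENUINE `AbsTopMonoids` at `S = ofDoubleUnderline C μ …` (`O^⊳(G) = 𝒪^⊳_{ℚ̄_p}`, `Ism(G)` = print's isometry group)
for which `Rmk181_statement` HOLDS — no residual binder. [claim: Mochizuki2012, status: disputed] (IUTchII §1 Rmk 1.8.1, kurims pp.41-42) -/
theorem exists_allGenuine_rmk181_ofDoubleUnderlinePadic_modelχq :
    ∃ A : AbsTopMonoids (ThetaSetting.ofDoubleUnderline C μ hC hS hl hp2 hpl hζ hη),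
      (∀ G, A.Otri G =
        (ModelMLFGaloisData.galois
          (Literature.AnabelianGeometry.EtaleTheta.ThetaSetting.modelχq p i j hj).toTemperedCurve.mlfClosurePadic.k
          (Literature.AnabelianGeometry.EtaleTheta.ThetaSetting.modelχq p i j hj).toTemperedCurve.mlfClosurePadic.K).tmPair.M) ∧
      (∀ G, A.Ism G = ↥(A.ism G)) ∧ Rmk181_statement A :=
  exists_allGenuine_rmk181_ofDoubleUnderlinePadic_modelχq_of_ker_ne_bot p i j hj C μ hC hS hl hp2 hpl hζ hη
    (ker_tatePairHom_ne_bot p i j)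

/-- **ONE producer with all the laws at the Tate model, UNCONDITIONALLY** — `genuineOfModelIsm` at `S = ofDoubleUnderline C μ …`
over `modelχq p i j`, closure `(K, ℚ̄_p)`, `ε = galoisEpsilonPadic`: `O^⊳(G) = 𝒪^⊳_{ℚ̄_p}`, `Ism(G)` = print's isometry group,
`−1` acts on `O^{×μ}(G)` by inversion, the continuity laws of Ex. 1.8 (ii), Rmk. 1.11.1 (i) (a) (`Rmk1111_a`) and (d)
(`Rmk1111_d`), and Rmk. 1.8.1 (`Rmk181_statement`) all HOLD — no residual binder.
[claim: Mochizuki2012, status: disputed] (IUTchII §1 Rmk 1.11.1 (i), kurims pp.49-50) -/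
theorem exists_allGenuine_laws_ofDoubleUnderlinePadic_modelχq :
    ∃ A : AbsTopMonoids (ThetaSetting.ofDoubleUnderline C μ hC hS hl hp2 hpl hζ hη),
      (∀ G, A.Otri G =
        (ModelMLFGaloisData.galois
          (Literature.AnabelianGeometry.EtaleTheta.ThetaSetting.modelχq p i j hj).toTemperedCurve.mlfClosurePadic.k
          (Literature.AnabelianGeometry.EtaleTheta.ThetaSetting.modelχq p i j hj).toTemperedCurve.mlfClosurePadic.K).tmPair.M) ∧
      (∀ G, A.Ism G = ↥(A.ism G)) ∧
      (∀ (G : IsoClass (ThetaSetting.ofDoubleUnderline C μ hC hS hl hp2 hpl hζ hη).Gk) (x : A.Oxmu G),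
        A.actIsm G (A.toIsm G ZHatLevel.negOneAut) x = x⁻¹) ∧
      A.ContinuityLaws ∧ Rmk1111_a A ∧ Rmk1111_d A ∧ Rmk181_statement A :=
  exists_allGenuine_laws_ofDoubleUnderlinePadic_modelχq_of_ker_ne_bot p i j hj C μ hC hS hl hp2 hpl hζ hη
    (ker_tatePairHom_ne_bot p i j)

end AbsTopMonoids

end Literature.IUT.HodgeArakelov

end
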